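import Mathlib
import HarnessLib
import Literature.Computability.AlgebraicComplexity.SymmetricArithCircuit
import Literature.Computability.AlgebraicComplexity.ArithCircuit
import Literature.Computability.AlgebraicComplexity.ArithCircuitProofs
import Literature.Computability.AlgebraicComplexity.ArithCircuitChain
import Summits.ValiantsHypothesis.ValiantsHypothesis.Theses.SymmetryDial

/-!
# Route `SymmetryDial` — plumbing: a labelled (unbounded fan-in, DAG) circuit yields a fan-in-two program

Helper file of the route `Theses/SymmetryDial.lean` (decomp-valiant workshop, lens 1, generation 2; authored by the
lens seat; answers the critic's w1).  It PROVES the route's aside item `LabelledCircuitComplexity`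
(stmt-ValiantsHypothesis-23682): for every Dawar–Wilsenach labelled arithmetic circuit `C` on a finite gate set `G`,
`complexity (C.eval (C.output ())) ≤ |G|²` — indeed `complexity (C.eval g) ≤ |G|²` at EVERY gate, over any
commutative semiring.  Proof: enumerate the gates by the slot `height(g)·|G| + index(g)` (children have smaller
height, hence smaller slot), and run the tree's dynamic-programming bound `complexity_chain_le`
(`ArithCircuitChain.lean`, Bürgisser 2000 Rem. 2.7) on the table whose step at the slot of `g` is `X x`, `C c`,
`Σ_{h ∈ children g} X_{slot h}` or `∏_{h ∈ children g} X_{slot h}`; a gate with `m ≤ |G| − 1` children costs `≤ m`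
fan-in-two operations, empty slots cost `0`, so the whole table costs `≤ |G|·|G|`.
With this theorem the necessity `S ⟹ SymHardAffine` of the lens Sketch (`symHardAffine_of_summit hL hS`) is
unconditional.  Unconditional, 0 sorry, NO new definitions (all bookkeeping is proof-local), closes item 23682 by type match.  References: [Burgisser2000] Rem. 2.7; [DawarWilsenach2025] Def. 2.2.
-/

-- layout Summits/ValiantsHypothesis/ValiantsHypothesis forces the duplicated namespace component
set_option linter.dupNamespace false

namespace Summit.ValiantsHypothesis.ValiantsHypothesis.Theorems.SymmetryDialPlumbing

open MvPolynomial Literature.Computability.AlgebraicComplexity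

noncomputable section

universe u v w z

variable {k : Type u} {ι : Type v} {Y : Type z} {G : Type w}

/-! ### Three small cost lemmas -/

section Cost

variable [CommSemiring k]

/-- A sum of `|s|` variables costs `≤ |s|` fan-in-two operations. [cite: Burgisser2000, §2.1] -/
theorem complexity_sum_X_le {τ : Type*} (s : Finset G) (v : G → τ) :
    complexity (∑ h ∈ s, (X (v h) : MvPolynomial τ k)) ≤ s.card := by
  induction s using Finset.cons_induction with
  | empty =>
    have h0 : complexity (0 : MvPolynomial τ k) = 0 := by rw [← C_0]; exact complexity_C_holds _
    simp only [Finset.sum_empty, Finset.card_empty, h0, le_refl]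
  | cons a s ha ih =>
    rw [Finset.sum_cons, Finset.card_cons ha]
    have h1 := complexity_add_le_holds (X (v a) : MvPolynomial τ k) (∑ h ∈ s, X (v h))
    have h2 := complexity_X_holds (k := k) (σ := τ) (v a)
    omega

/-- A product of `|s|` variables costs `≤ |s|` fan-in-two operations. [cite: Burgisser2000, §2.1] -/
theorem complexity_prod_X_le {τ : Type*} (s : Finset G) (v : G → τ) :
    complexity (∏ h ∈ s, (X (v h) : MvPolynomial τ k)) ≤ s.card := by
  induction s using Finset.cons_induction with
  | empty =>
    have h0 : complexity (1 : MvPolynomial τ k) = 0 := by rw [← C_1]; exact complexity_C_holds _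
    simp only [Finset.prod_empty, Finset.card_empty, h0, le_refl]
  | cons a s ha ih =>
    rw [Finset.prod_cons, Finset.card_cons ha]
    have h1 := complexity_mul_le_holds (X (v a) : MvPolynomial τ k) (∏ h ∈ s, X (v h))
    have h2 := complexity_X_holds (k := k) (σ := τ) (v a)
    omega

/-- Crude subadditivity over a finset: `L(Σ_{i∈s} p_i) ≤ Σ_{i∈s} (L(p_i) + 1)`. [cite: Burgisser2000, §2.1] -/
theorem complexity_finset_sum_le_succ {α τ : Type*} (s : Finset α) (p : α → MvPolynomial τ k) :
    complexity (∑ i ∈ s, p i) ≤ ∑ i ∈ s, (complexity (p i) + 1) := by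
  induction s using Finset.cons_induction with
  | empty =>
    have h0 : complexity (0 : MvPolynomial τ k) = 0 := by rw [← C_0]; exact complexity_C_holds _
    simp only [Finset.sum_empty, h0, le_refl]
  | cons a s ha ih =>
    rw [Finset.sum_cons, Finset.sum_cons]
    have h1 := complexity_add_le_holds (p a) (∑ i ∈ s, p i)
    omega

end Cost

/-! ### The bound -/

/-- **Every gate of a labelled circuit on `|G|` gates has fan-in-two complexity `≤ |G|²`.**  Proof-local
bookkeeping (no definitions): heights `ht` by well-founded recursion along the wires, slots
`ht g · |G| + index g`, the value table `fval` and the step table `stepT` as sums over the fibres of the slot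
map, then `complexity_chain_le`. [cite: Burgisser2000, Rem. 2.7] -/
theorem complexity_eval_le [CommSemiring k] (C : LabelledArithCircuit k ι Y G) [Fintype G] (g₀ : G) :
    complexity (C.eval g₀) ≤ Fintype.card G ^ 2 := by
  classical
  -- 1. heights
  obtain ⟨ht, ht_eq⟩ : ∃ ht : G → ℕ, ∀ g, ht g = (C.children g).sup (fun h => ht h + 1) :=
    ⟨C.wf.fix (fun g rec => (C.children g).attach.sup fun h => rec h.1 h.2 + 1), fun g => by
      rw [WellFounded.fix_eq]
      exact Finset.sup_attach (C.children g) (fun h => C.wf.fix _ h + 1)⟩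
  have ht_lt : ∀ {h g : G}, h ∈ C.children g → ht h < ht g := by
    intro h g hh
    rw [ht_eq g]
    exact Nat.lt_of_lt_of_le (Nat.lt_succ_self _) (Finset.le_sup (f := fun h => ht h + 1) hh)
  have hirr : ∀ g : G, g ∉ C.children g := fun g hg => lt_irrefl _ (ht_lt hg)
  have hN : 0 < Fintype.card G := Fintype.card_pos_iff.mpr ⟨g₀⟩
  -- 2. slots
  obtain ⟨slot, slot_def⟩ :
      ∃ slot : G → ℕ, ∀ g, slot g = ht g * Fintype.card G + (Fintype.equivFin G g : ℕ) :=
    ⟨_, fun _ => rfl⟩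
  set T : ℕ := (Finset.univ.sup ht + 1) * Fintype.card G with hT
  have slot_lt : ∀ g, slot g < T := by
    intro g
    have h1 : ht g ≤ Finset.univ.sup ht := Finset.le_sup (f := ht) (Finset.mem_univ g)
    have h2 : ((Fintype.equivFin G g : Fin _) : ℕ) < Fintype.card G := (Fintype.equivFin G g).isLt
    have h3 : ht g * Fintype.card G ≤ Finset.univ.sup ht * Fintype.card G :=
      Nat.mul_le_mul_right _ h1
    rw [slot_def, hT, Nat.add_mul, one_mul]
    linarith
  have slot_lt_of_mem : ∀ {h g : G}, h ∈ C.children g → slot h < slot g := by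
    intro h g hh
    have h1 : ht h + 1 ≤ ht g := ht_lt hh
    have h2 : ((Fintype.equivFin G h : Fin _) : ℕ) < Fintype.card G := (Fintype.equivFin G h).isLt
    have h3 : (ht h + 1) * Fintype.card G ≤ ht g * Fintype.card G := Nat.mul_le_mul_right _ h1
    rw [Nat.add_mul, one_mul] at h3
    rw [slot_def, slot_def]
    linarith
  have slot_mod : ∀ g, slot g % Fintype.card G = (Fintype.equivFin G g : ℕ) := by
    intro g
    rw [slot_def, Nat.mul_comm, Nat.mul_add_mod]
    exact Nat.mod_eq_of_lt (Fintype.equivFin G g).isLt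
  have slot_inj : Function.Injective slot := by
    intro a b hab
    have h := slot_mod a
    rw [hab, slot_mod b] at h
    exact (Fintype.equivFin G).injective (Fin.ext h.symm)
  obtain ⟨sF, sF_val⟩ : ∃ sF : G → Fin T, ∀ g, (sF g : ℕ) = slot g :=
    ⟨fun g => ⟨slot g, slot_lt g⟩, fun _ => rfl⟩
  have sF_inj : Function.Injective sF := fun a b hab =>
    slot_inj (by rw [← sF_val a, ← sF_val b, hab])
  have sF_lt : ∀ {h g : G}, h ∈ C.children g → sF h < sF g := fun hh =>
    Fin.lt_def.mpr (by rw [sF_val, sF_val]; exact slot_lt_of_mem hh)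
  -- 3. the tables
  obtain ⟨fval, fval_def⟩ : ∃ fval : Fin T → MvPolynomial ι k,
      ∀ t, fval t = ∑ g ∈ Finset.univ.filter (fun g => sF g = t), C.eval g := ⟨_, fun _ => rfl⟩
  obtain ⟨step, step_def⟩ : ∃ step : G → MvPolynomial (ι ⊕ Fin T) k, ∀ g, step g =
      if (C.label g).IsInput then rename Sum.inl (C.eval g)
      else if C.label g = CircuitLabel.add then ∑ h ∈ C.children g, X (Sum.inr (sF h))
      else ∏ h ∈ C.children g, X (Sum.inr (sF h)) := ⟨_, fun _ => rfl⟩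
  obtain ⟨stepT, stepT_def⟩ : ∃ stepT : Fin T → MvPolynomial (ι ⊕ Fin T) k,
      ∀ t, stepT t = ∑ g ∈ Finset.univ.filter (fun g => sF g = t), step g := ⟨_, fun _ => rfl⟩
  have fval_slot : ∀ g, fval (sF g) = C.eval g := by
    intro g
    rw [fval_def, Finset.sum_eq_single_of_mem g (by simp)]
    intro b hb hne
    exact absurd (sF_inj (Finset.mem_filter.mp hb).2) hne
  have step_spec : ∀ (g : G) (t : Fin T), sF g = t →
      C.eval g = aeval (Sum.elim X (fun s : Fin T => if s < t then fval s else 0)) (step g) := by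
    intro g t hgt
    rcases hl : C.label g with x | c | _ | _
    · have hI : (C.label g).IsInput := by rw [hl]; exact CircuitLabel.isInput_var x
      rw [step_def, if_pos hI, aeval_rename, Sum.elim_comp_inl, aeval_X_left_apply]
    · have hI : (C.label g).IsInput := by rw [hl]; exact CircuitLabel.isInput_const c
      rw [step_def, if_pos hI, aeval_rename, Sum.elim_comp_inl, aeval_X_left_apply]
    · have hI : ¬ (C.label g).IsInput := by rw [hl]; exact CircuitLabel.not_isInput_add
      rw [step_def, if_neg hI, if_pos hl, C.eval_of_label_add hl]
      simp only [map_sum, aeval_X, Sum.elim_inr]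
      refine Finset.sum_congr rfl (fun h hh => ?_)
      rw [if_pos (lt_of_lt_of_eq (sF_lt hh) hgt), fval_slot]
    · have hI : ¬ (C.label g).IsInput := by rw [hl]; exact CircuitLabel.not_isInput_mul
      have hne : C.label g ≠ CircuitLabel.add := by
        rw [hl]; intro h; cases h
      rw [step_def, if_neg hI, if_neg hne, C.eval_of_label_mul hl]
      simp only [map_prod, aeval_X, Sum.elim_inr]
      refine Finset.prod_congr rfl (fun h hh => ?_)
      rw [if_pos (lt_of_lt_of_eq (sF_lt hh) hgt), fval_slot]
  have chain_spec : ∀ t : Fin T,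
      fval t = aeval (Sum.elim X (fun s : Fin T => if s < t then fval s else 0)) (stepT t) := by
    intro t
    rw [stepT_def, map_sum, fval_def t]
    refine Finset.sum_congr rfl (fun g hg => ?_)
    exact step_spec g t (Finset.mem_filter.mp hg).2
  -- 4. costs
  have card_children_le : ∀ g, (C.children g).card ≤ Fintype.card G - 1 := by
    intro g
    have hsub : C.children g ⊆ Finset.univ.erase g := by
      intro h hh
      refine Finset.mem_erase.mpr ⟨?_, Finset.mem_univ h⟩
      rintro rfl
      exact hirr h hh
    calc (C.children g).card ≤ (Finset.univ.erase g).card := Finset.card_le_card hsub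
      _ = Fintype.card G - 1 := by
          rw [Finset.card_erase_of_mem (Finset.mem_univ g), Finset.card_univ]
  have step_cost : ∀ g, complexity (step g) + 1 ≤ Fintype.card G := by
    intro g
    have hch := card_children_le g
    rcases hl : C.label g with x | c | _ | _
    · have hI : (C.label g).IsInput := by rw [hl]; exact CircuitLabel.isInput_var x
      rw [step_def, if_pos hI, C.eval_of_label_var hl, rename_X]
      have := complexity_X_holds (k := k) (σ := ι ⊕ Fin T) (Sum.inl x)
      omega
    · have hI : (C.label g).IsInput := by rw [hl]; exact CircuitLabel.isInput_const c
      rw [step_def, if_pos hI, C.eval_of_label_const hl, rename_C]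
      have := complexity_C_holds (k := k) (σ := ι ⊕ Fin T) c
      omega
    · have hI : ¬ (C.label g).IsInput := by rw [hl]; exact CircuitLabel.not_isInput_add
      rw [step_def, if_neg hI, if_pos hl]
      have := complexity_sum_X_le (k := k) (C.children g) (fun h => (Sum.inr (sF h) : ι ⊕ Fin T))
      omega
    · have hI : ¬ (C.label g).IsInput := by rw [hl]; exact CircuitLabel.not_isInput_mul
      have hne : C.label g ≠ CircuitLabel.add := by
        rw [hl]; intro h; cases h
      rw [step_def, if_neg hI, if_neg hne]
      have := complexity_prod_X_le (k := k) (C.children g) (fun h => (Sum.inr (sF h) : ι ⊕ Fin T))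
      omega
  -- 5. the chain bound
  have hchain := complexity_chain_le fval stepT chain_spec (sF g₀)
  rw [fval_slot] at hchain
  refine hchain.trans ?_
  calc ∑ t : Fin T, complexity (stepT t)
      ≤ ∑ t : Fin T, ∑ g ∈ Finset.univ.filter (fun g => sF g = t), (complexity (step g) + 1) :=
        Finset.sum_le_sum fun t _ => by rw [stepT_def]; exact complexity_finset_sum_le_succ _ _
    _ = ∑ g : G, (complexity (step g) + 1) := Finset.sum_fiberwise Finset.univ sF _
    _ ≤ ∑ _g : G, Fintype.card G := Finset.sum_le_sum fun g _ => step_cost g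
    _ = Fintype.card G ^ 2 := by rw [Finset.sum_const, Finset.card_univ, smul_eq_mul, sq]

end

/-- **The route's aside item `LabelledCircuitComplexity` (stmt-ValiantsHypothesis-23682), proved.**
[cite: Burgisser2000, Rem. 2.7] -/
theorem labelledCircuitComplexity_holds :
    Summit.ValiantsHypothesis.ValiantsHypothesis.Theses.SymmetryDial.LabelledCircuitComplexity := by
  intro X G _ C
  exact complexity_eval_le C (C.output ())

end Summit.ValiantsHypothesis.ValiantsHypothesis.Theorems.SymmetryDialPlumbing
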